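import Summits.BirchSwinnertonDyer.BirchSwinnertonDyer.Theses.KatoTransfer
import Summits.BirchSwinnertonDyer.BirchSwinnertonDyer.Theses.SelmerRank
import Summits.BirchSwinnertonDyer.BirchSwinnertonDyer.Theorems.Consistency.Negative.ConsistencyFalseWithoutNewform
import Summits.BirchSwinnertonDyer.BirchSwinnertonDyer.Theorems.PinchPrime.Negative.ContentOfCrux

/-! # Crux-attack probes — `KatoTransfer.AnalyticRankLeSelmerCorank` (stmt-BirchSwinnertonDyer-18412)

refuter-rattack-stmt-BirchSwinnertonDyer-18412-0, 2026-08-17 (crux attack at birth, route KatoTransfer).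
`probe` and the first `example` are the deliberate elaboration sorries; everything else is sorry-free
(axioms propext / Classical.choice / Quot.sound, checked for (2'), (7), (8)).
Findings: (2) S → C hypothesis-free (BSD-rank + the PROVED Kummer identity
`selmerCorank_eq_mordellWeilRank_add_holds`); (3) hypotheses inhabited at (E₁ = 32a2, p = 5) and the
instance TRUE there (r_an(E₁) = 0); (4) C + X1 = the lower-bound half of BSD on minimal models;
(6) the BC3 birth split `stub_weakBoundCorankGeTwo` + `stub_pParityAdmissible` IS the crux on s_p ≥ 2;
(7) C ⇒ the shared crux stmt-BirchSwinnertonDyer-0131 `SelmerRank.SelmerRankLB` (C = 0131 minus the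
big-image hypothesis); (8) stmt-0131 ∧ stmt-14418 `SelmerRank.SelmerRankSmallImage` ⇒ C.
Verdict: SURVIVES (see CruxAttack-r1.md). -/

set_option linter.dupNamespace false

open Summit.BirchSwinnertonDyer.BirchSwinnertonDyer.Theses.KatoTransfer
open Literature.NumberTheory.EllipticCurves

-- (1) the decl elaborates
theorem probe : AnalyticRankLeSelmerCorank := by
  sorry

-- (1') the body verbatim elaborates
example : ∀ (W : WeierstrassCurve ℚ) [W.IsElliptic] [W.IsGloballyMinimal] (p : ℕ) [Fact p.Prime],
    5 ≤ p → W.HasGoodReductionAtPrime p → ¬ (p : ℤ) ∣ W.frobeniusTrace p →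
      W.analyticRank ≤ W.selmerCorank p := by
  sorry

-- (1'') the decl IS the body (defeq check)
example : AnalyticRankLeSelmerCorank ↔
    ∀ (W : WeierstrassCurve ℚ) [W.IsElliptic] [W.IsGloballyMinimal] (p : ℕ) [Fact p.Prime],
    5 ≤ p → W.HasGoodReductionAtPrime p → ¬ (p : ℤ) ∣ W.frobeniusTrace p →
      W.analyticRank ≤ W.selmerCorank p := Iff.rfl

-- (2) S → C at EVERY prime, no reduction hypothesis: BSD-rank + the PROVED Kummer identity
theorem analyticRank_le_selmerCorank_of_bsd (h : BirchSwinnertonDyer) (W : WeierstrassCurve ℚ)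
    [hE : W.IsElliptic] (p : ℕ) [Fact p.Prime] : W.analyticRank ≤ W.selmerCorank p := by
  have hid := WeierstrassCurve.selmerCorank_eq_mordellWeilRank_add_holds W p
  have hb : W.analyticRank = W.mordellWeilRank := h W hE
  omega

-- (2') hence S → C
theorem analyticRankLeSelmerCorank_of_bsd (h : BirchSwinnertonDyer) : AnalyticRankLeSelmerCorank :=
  fun W _ _ p _ _ _ _ => analyticRank_le_selmerCorank_of_bsd h W p

-- (3) hypotheses satisfiable: E₁ = 32a2 = congruentNumberCurve 1 at p = 5 (good ordinary, a₅ = -2)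
example : ∃ (W : WeierstrassCurve ℚ) (_ : W.IsElliptic) (_ : W.IsGloballyMinimal) (p : ℕ)
    (_ : Fact p.Prime), 5 ≤ p ∧ W.HasGoodReductionAtPrime p ∧ ¬ (p : ℤ) ∣ W.frobeniusTrace p := by
  haveI : Fact (Nat.Prime 5) := ⟨by norm_num⟩
  haveI : (congruentNumberCurve 1).IsElliptic := isElliptic_congruentNumberCurve one_ne_zero
  haveI : (congruentNumberCurve 1).IsGloballyMinimal :=
    isGloballyMinimal_congruentNumberCurve squarefree_one
  exact ⟨congruentNumberCurve 1, inferInstance, inferInstance, 5, inferInstance, le_rfl,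
    hasGoodReductionAtPrime_congruentNumberCurve (by norm_num),
    Summit.BirchSwinnertonDyer.BirchSwinnertonDyer.Theorems.ConsistencyNegative.not_five_dvd_frobeniusTrace_congruentNumberCurve_one⟩

-- (3') and the instance of C at that witness is TRUE (r_an(E₁) = 0), so no kill from E₁
example (p : ℕ) [Fact p.Prime] [(congruentNumberCurve 1).IsElliptic] :
    (congruentNumberCurve 1).analyticRank ≤ (congruentNumberCurve 1).selmerCorank p := by
  rw [Summit.BirchSwinnertonDyer.BirchSwinnertonDyer.Theorems.PinchPrime.Negative.analyticRank_congruentNumberCurve_one]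
  exact Nat.zero_le _

-- (4) what C buys in `closes`: C + X1 give the lower-bound half of BSD on global minimal models
example (hX1 : ShaCorankZeroAtOnePrime) (hX2 : AnalyticRankLeSelmerCorank)
    (W : WeierstrassCurve ℚ) [W.IsElliptic] [W.IsGloballyMinimal] :
    W.analyticRank ≤ W.mordellWeilRank := by
  obtain ⟨p, hp, h5, hgood, hord, hsha⟩ := hX1 W
  have hid := WeierstrassCurve.selmerCorank_eq_mordellWeilRank_add_holds W p
  have h2 := hX2 W p h5 hgood hord
  omega

-- (6) the BC3 birth split is cosmetic on the sector s_p ≥ 2: modulo p-parity (stub_pParityAdmissible),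
--     stub_weakBoundCorankGeTwo (2 ≤ s_p → r_an ≤ s_p + 1) IS the crux restricted to 2 ≤ s_p.
example (W : WeierstrassCurve ℚ) (p : ℕ) (hpar : W.selmerCorank p % 2 = W.analyticRank % 2) :
    (2 ≤ W.selmerCorank p → W.analyticRank ≤ W.selmerCorank p + 1) ↔
    (2 ≤ W.selmerCorank p → W.analyticRank ≤ W.selmerCorank p) := by omega

-- (7) C DOMINATES the existing shared crux stmt-BirchSwinnertonDyer-0131 `SelmerRank.SelmerRankLB`
--     (verbatim the same statement plus the big-image hypothesis `HasSurjectiveModNGaloisRep p`):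
theorem selmerRankLB_of_analyticRankLeSelmerCorank (h : AnalyticRankLeSelmerCorank) :
    Summit.BirchSwinnertonDyer.BirchSwinnertonDyer.Theses.SelmerRank.SelmerRankLB :=
  fun W _ _ p _ h5 hg ho _ => h W p h5 hg ho

-- (7') and the R2 copy stmt-0485
theorem selmerRankLBR2_of_analyticRankLeSelmerCorank (h : AnalyticRankLeSelmerCorank) :
    Summit.BirchSwinnertonDyer.BirchSwinnertonDyer.Theses.SelmerRank.SelmerRankLBR2 :=
  fun W _ _ p _ h5 hg ho _ => h W p h5 hg ho

-- (8) conversely C is IMPLIED by two existing registered items of route SelmerRank: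
--     stmt-0131 `SelmerRankLB` (big image) and `SelmerRankSmallImage` (non-surjective image, equality):
theorem analyticRankLeSelmerCorank_of_LB_of_smallImage
    (hLB : Summit.BirchSwinnertonDyer.BirchSwinnertonDyer.Theses.SelmerRank.SelmerRankLB)
    (hSI : Summit.BirchSwinnertonDyer.BirchSwinnertonDyer.Theses.SelmerRank.SelmerRankSmallImage) :
    AnalyticRankLeSelmerCorank := by
  intro W _ _ p _ h5 hg ho
  by_cases hs : W.HasSurjectiveModNGaloisRep p
  · exact hLB W p h5 hg ho hs
  · exact (hSI W p h5 hg ho hs).ge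

-- (5) triviality probes on the conclusion shape (expected to fail; kept commented after the run)
-- example (W : WeierstrassCurve ℚ) [W.IsElliptic] [W.IsGloballyMinimal] (p : ℕ) [Fact p.Prime]
--     (h5 : 5 ≤ p) (hg : W.HasGoodReductionAtPrime p) (ho : ¬ (p : ℤ) ∣ W.frobeniusTrace p) :
--     W.analyticRank ≤ W.selmerCorank p := by first | simp | omega | positivity | aesop | exact?
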